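import Summits.QuantumFields.YangMills.Theorems.UnitScaleTiltHalvingP1FlatCoreTopDictionary
import Summits.QuantumFields.YangMills.Theorems.UnitScaleTiltHalvingP1FlatCoreFrameLinLocal
import Summits.QuantumFields.YangMills.Theorems.UnitScaleTiltHalvingP1FlatCoreFrameLinLipschitzLocal
import Literature.MathematicalPhysics.QuantumFieldTheory.Balaban1983to89.BlockAveragingEMLLinearised
import HarnessLib

/-!
# Line H (`BirthV10.stub_halvingStep`, stmt-QuantumFields-19200), J4c **(T4b) FILE 3: THE TOP ROWS FROM THE LOCAL TOWER INDUCTION** — the hypotheses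
# `hTop121`∕… of ✓`P1FlatCoreTopStepTorus.hFP_kLevel_top_RD` (the three top rows in torus letters on the `ℤᵈ` tower box) DISCHARGED from ★w3-19936 g6's
# LOCAL effective-gauge tower rows (✓`P1FlatCoreFrameLinLocal`, F2-local) through the site family «level-`j` covers of the labels under the top label»
# and the oscillation transfer ✓`P1FlatCoreTopDictionary.norm_siteAvgIter_coverAt_sub_le`

Cell `ym3-torus` (HUMAN RULING D-0037: YM₃ on T³ is ladder rung R3, NOT the Clay problem), width seat `ym-ust-19936-w8` gen 2.
`--supports stmt-QuantumFields-19200 --as helper`; THEOREMS ONLY (0 `def`, 0 `sorry`); count-neutral; nothing here claims `core′`, the stub, the crux or the gap.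

WHAT.
* §1 the site family `S^{yc} j := {π_j z | ⌊z ∕ L^{k−j}⌋ = yc}` (level-`j` covers of the labels under the top label `yc`): closure under the block centre
  (`emb`, ✓`Node00.emb_coverAt`) and the stair ends (✓`walkEnd_emb_stairWord_eq_blockSite` + ✓`P1FlatCoreTopDictionary.blockSite_coverAt`) — the
  `hSe`∕`hSs` of ✓`P1FlatCoreFrameLinLocal`; its level-`0` member is the cover of the tower box `[tlo L yc k, thi L yc k]`; every `Lʲ`-block of a label
  under `yc` lies in that box.
* §2 ★★ `top121_of_local` — the `hTop121` text of ✓`hFP_kLevel_top_RD` at a top label `yc` (value row (1.121) + `exp ∘ log = id` for the top effective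
  gauge) FROM ✓`P1FlatCoreFrameLinLocal.norm_mlog_effGauge_top_sub_siteAvgIter_le_local` at `S^{yc}`: sup transfer `‖l₀‖ ≤ α₄` on `S^{yc} 0`, oscillation
  transfer `ω := d·L·α₄∕2` from the gradient row `α₄L^{−k}` (✓`norm_siteAvgIter_coverAt_sub_le`, `Lʲ∕Lᵏ ≤ 2ʲ∕2ᵏ`), stairs `δ` DISPLAYED on the blocks
  under `yc` (supplier: ✓`P1FlatCoreFrameLinStar`'s block-local stair bounds from the near-flatness of the charted iterate), window `160(α₄ + δ + 5ω) ≤ ¼`;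
  constant `Cb := 640(α₄ + δ + 5ω)ω`.
HONEST SCOPE.  Bookkeeping; the analysis is ★w3-19936 g6's tower induction; the (1.125) and reality rows (`hTop125`∕`hTopReal`) follow the same pattern from
F3∕F4-local: §4 (v1.1) `top125_of_local` from ✓`P1FlatCoreFrameLinLipschitzLocal.norm_Cnl_sub_Cnl_le_local` (two regimes in the modulus `m`: Cauchy for
`dLm ≤ r∕4`, two value bounds otherwise); `topReal_of_local` = v1.2 APPEND when ✓`…FrameLinRealLocal` is in the tree.  Nothing of
[Balaban1985RegularSpaces] Prop. 5 ∕ Sect. E is proved here.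

References: T. Bałaban, CMP **99** (1985) 75–102 [Balaban1985RegularSpaces] (Sect. E (1.120)–(1.121) pp.95–96); CMP **98** (1985) 17–51 [Balaban1985Averaging]
((97)–(100) p.32, (110) p.34); CMP **116** (1988) [Balaban1987RG1] ((0.1)–(0.3) pp.251–252).
-/

set_option autoImplicit false

noncomputable section

open scoped BigOperators
open NormedSpace

namespace Summit.QuantumFields.YangMills.Theorems.P1FlatCoreTopRowsLocal

open Literature.MathematicalPhysics.QuantumFieldTheory.Balaban1983to89
open T4Continuum BlockAveraging ExpMeanLog MatrixLog
open B10Eq27TorusAxialLog (holT gaugeActT)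
open LatticeFieldCalculus (siteAvgIter)
open B15Eq112TorusCover (cover)
open B14DomainGeom (Pt)
open Node00 (coverAt coverAt_zero emb_coverAt blockMap_blockMap)
open Literature.MathematicalPhysics.QuantumLattice (blockMap blockBase blockSites mem_blockSites_iff blockMap_blockBase_add_of_lt)
open B7Prop1Explicit (e l1)
open B7Prop1Local (InBox)
open B8Ineq130 (tlo thi)
open BlockAveragingEMLLinearised (walkEnd_emb_stairWord_eq_blockSite)
open Summit.QuantumFields.YangMills.Theorems.Prop8ChartDoubleBar (vframeU dbarIterU)
open Summit.QuantumFields.YangMills.Theorems.P1FlatCoreFrameLinLocal (norm_mlog_effGauge_top_sub_siteAvgIter_le_local)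
open Summit.QuantumFields.YangMills.Theorems.P1FlatCoreTopDictionary (blockSite_coverAt norm_siteAvgIter_coverAt_sub_le
  inBox_tlo_thi_iff_mem_blockSites)

variable {P : Params}

/-! ## §1 The site family of the tower under a top label -/

section Family

/-- `⌊(L·z + t)∕L⌋ = z` for an offset `0 ≤ t < L`. [folklore] -/
theorem blockMap_L_smul_add (z : Pt P.d) (t : Pt P.d) (h0 : ∀ i, 0 ≤ t i) (ht : ∀ i, t i < P.L) :
    blockMap P.L ((fun μ => (P.L : ℤ) * z μ) + t) = z :=
  blockMap_blockBase_add_of_lt P.L z t h0 ht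

/-- Labels compose down the tower: `⌊w∕Lʲ⌋ = L·z + t` (`0 ≤ t < L`) and `⌊z∕L^{i}⌋ = yc` give `⌊w∕L^{j+1+i}⌋ = yc`. [folklore] -/
theorem blockMap_pow_of_blockMap_pow_eq {j i : ℕ} {w z yc : Pt P.d} {t : Pt P.d} (h0 : ∀ μ, 0 ≤ t μ) (ht : ∀ μ, t μ < P.L)
    (hw : blockMap (P.L ^ j) w = (fun μ => (P.L : ℤ) * z μ) + t) (hz : blockMap (P.L ^ i) z = yc) :
    blockMap (P.L ^ (j + 1 + i)) w = yc := by
  rw [show P.L ^ (j + 1 + i) = P.L ^ j * P.L * P.L ^ i by ring, ← blockMap_blockMap, ← blockMap_blockMap, hw,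
    blockMap_L_smul_add z t h0 ht, hz]

/-- The centred offset `(L−1)∕2` is an admissible offset. [folklore] -/
theorem half_pred_lt_L : ((P.L - 1) / 2 : ℕ) < P.L := by
  have := P.hL.2; omega

/-- **CLOSURE UNDER THE BLOCK CENTRE**: if `π_{j+1} z` lies over `yc` then so does `emb (π_{j+1} z) = π_j (L·z + (L−1)∕2)`. [cite: Balaban1987RG1, (0.1) p.251] -/
theorem emb_mem_family {k j : ℕ} (hj : j < k) (hk : k ≤ P.m + P.K) (yc z : Pt P.d) (hz : blockMap (P.L ^ (k - (j + 1))) z = yc) :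
    ∃ w : Pt P.d, blockMap (P.L ^ (k - j)) w = yc ∧ emb (coverAt P (j + 1) z) = coverAt P j w := by
  refine ⟨fun μ => (P.L : ℤ) * z μ + ((P.L - 1) / 2 : ℕ), ?_, emb_coverAt (by omega) z⟩
  have hsplit : (fun μ => (P.L : ℤ) * z μ + ((P.L - 1) / 2 : ℕ)) = (fun μ => (P.L : ℤ) * z μ) + fun _ => (((P.L - 1) / 2 : ℕ) : ℤ) := by
    funext μ; rfl
  have hkj : k - j = 0 + 1 + (k - (j + 1)) := by omega
  rw [hkj]
  exact blockMap_pow_of_blockMap_pow_eq (j := 0) (z := z) (t := fun _ => (((P.L - 1) / 2 : ℕ) : ℤ)) (fun _ => by positivity)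
    (fun _ => by exact_mod_cast half_pred_lt_L) (by rw [pow_zero, hsplit]; funext μ; simp [blockMap]) hz

/-- **CLOSURE UNDER THE STAIR ENDS**: if `π_{j+1} z` lies over `yc` then so does every stair end `blockSite (π_{j+1} z) r = π_j (L·z + r)`.
[cite: Balaban1987RG1, (0.3) p.252] -/
theorem stairEnd_mem_family {k j : ℕ} (hj : j < k) (hk : k ≤ P.m + P.K) (yc z : Pt P.d) (hz : blockMap (P.L ^ (k - (j + 1))) z = yc)
    (idx : Idx P) :
    ∃ w : Pt P.d, blockMap (P.L ^ (k - j)) w = yc ∧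
      walkEnd (emb (coverAt P (j + 1) z)) (stairWord idx.2.1 (off idx.1)) = coverAt P j w := by
  refine ⟨fun μ => (P.L : ℤ) * z μ + ((idx.1 μ : ℕ) : ℤ), ?_, ?_⟩
  · have hsplit : (fun μ => (P.L : ℤ) * z μ + ((idx.1 μ : ℕ) : ℤ)) = (fun μ => (P.L : ℤ) * z μ) + fun μ => ((idx.1 μ : ℕ) : ℤ) := by
      funext μ; rfl
    have hkj : k - j = 0 + 1 + (k - (j + 1)) := by omega
    rw [hkj]
    exact blockMap_pow_of_blockMap_pow_eq (j := 0) (z := z) (t := fun μ => ((idx.1 μ : ℕ) : ℤ)) (fun _ => by positivity)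
      (fun μ => by exact_mod_cast (idx.1 μ).isLt) (by rw [pow_zero, hsplit]; funext μ; simp [blockMap]) hz
  · rw [walkEnd_emb_stairWord_eq_blockSite, blockSite_coverAt (by omega)]

/-- **EVERY BLOCK UNDER `yc` LIES IN THE TOWER BOX**: if `⌊w∕L^{k−j}⌋ = yc` then the `Lʲ`-block of `w` lies in `[tlo L yc k, thi L yc k]`.
[cite: Balaban1985RegularSpaces, (1.6) p.77, (1.120) p.96] -/
theorem blockSites_subset_box {k j : ℕ} (hjk : j ≤ k) (yc w : Pt P.d) (hw : blockMap (P.L ^ (k - j)) w = yc) :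
    ∀ x ∈ blockSites (P.L ^ j) w, InBox (tlo P.L yc k) (thi P.L yc k) x := by
  haveI : NeZero (P.L ^ j) := ⟨pow_ne_zero _ P.L_pos.ne'⟩
  intro x hx
  rw [inBox_tlo_thi_iff_mem_blockSites P.L_pos, mem_blockSites_iff]
  · rw [mem_blockSites_iff] at hx
    rw [show P.L ^ k = P.L ^ j * P.L ^ (k - j) by rw [← pow_add]; congr 1; omega, ← blockMap_blockMap, hx, hw]

end Family

/-! ## §2 The rows' hypotheses on the family under `yc`, from the box hypotheses -/

section Transfer

variable {V : Type*} [NormedAddCommGroup V] [NormedSpace ℝ V]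

/-- `Lʲ∕Lᵏ ≤ 2ʲ∕2ᵏ` for `j ≤ k`, `L ≥ 2`. [folklore] -/
theorem pow_div_pow_le_two (hL : (2 : ℝ) ≤ P.L) {j k : ℕ} (hjk : j ≤ k) :
    (P.L : ℝ) ^ j * ((P.L : ℝ) ^ k)⁻¹ ≤ 2 ^ j / 2 ^ k := by
  have hL0 : (0 : ℝ) < P.L := by linarith
  obtain ⟨i, rfl⟩ := Nat.exists_eq_add_of_le hjk
  rw [pow_add, pow_add, mul_inv, ← mul_assoc, mul_inv_cancel₀ (by positivity), one_mul, div_eq_mul_inv, mul_inv, ← mul_assoc,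
    mul_inv_cancel₀ (by positivity), one_mul]
  exact inv_anti₀ (by positivity) (pow_le_pow_left₀ (by norm_num) hL i)

/-- The top label's cover lies in the family at level `k`. [folklore] -/
theorem coverAt_mem_family (k : ℕ) (yc : Pt P.d) :
    coverAt P k yc ∈ {w : Site P k | ∃ z : Pt P.d, blockMap (P.L ^ (k - k)) z = yc ∧ w = coverAt P k z} :=
  ⟨yc, by rw [Nat.sub_self, pow_zero]; funext i; simp [blockMap], rfl⟩

omit [NormedSpace ℝ V] in
/-- **SUP TRANSFER**: a bound on `l₀ ∘ π` on the tower box gives the bound on the level-`0` member of the family. [folklore] -/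
theorem sup_on_family {k : ℕ} (yc : Pt P.d) (l₀ : Site P 0 → V) {a : ℝ}
    (hb : ∀ x : Pt P.d, InBox (tlo P.L yc k) (thi P.L yc k) x → ‖l₀ (cover P x)‖ ≤ a) :
    ∀ x ∈ {w : Site P 0 | ∃ z : Pt P.d, blockMap (P.L ^ (k - 0)) z = yc ∧ w = coverAt P 0 z}, ‖l₀ x‖ ≤ a := by
  haveI : NeZero (P.L ^ k) := ⟨pow_ne_zero _ P.L_pos.ne'⟩
  rintro x ⟨z, hz, rfl⟩
  rw [coverAt_zero]
  rw [Nat.sub_zero] at hz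
  exact hb z ((inBox_tlo_thi_iff_mem_blockSites P.L_pos k yc z).2 ((mem_blockSites_iff _ _ _).2 hz))

/-- **OSCILLATION TRANSFER**: a step bound `t·L^{−k}` for `l₀ ∘ π` inside the tower box gives the linear oscillations
`‖(Q′_j l₀)(stair end) − (Q′_j l₀)(centre)‖ ≤ (dLt∕2)·2^{j+1}∕2ᵏ` on every block of the family (✓`norm_siteAvgIter_coverAt_sub_le`, `Lʲ∕Lᵏ ≤ 2ʲ∕2ᵏ`).
[cite: Balaban1985RegularSpaces, (1.120) p.96; Balaban1984PropagatorsI, (1.20) p.20] -/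
theorem osc_on_family {k : ℕ} (hk : k ≤ P.m + P.K) (yc : Pt P.d) (l₀ : Site P 0 → V) {t : ℝ} (ht : 0 ≤ t)
    (hg : ∀ (x : Pt P.d) (ν : Fin P.d), InBox (tlo P.L yc k) (thi P.L yc k) x → InBox (tlo P.L yc k) (thi P.L yc k) (x + e ν) →
      ‖l₀ (cover P (x + e ν)) - l₀ (cover P x)‖ ≤ t * ((P.L : ℝ) ^ k)⁻¹) :
    ∀ j < k, ∀ y ∈ {w : Site P (j + 1) | ∃ z : Pt P.d, blockMap (P.L ^ (k - (j + 1))) z = yc ∧ w = coverAt P (j + 1) z},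
      ∀ idx : Idx P,
        ‖siteAvgIter j l₀ (walkEnd (emb y) (stairWord idx.2.1 (off idx.1))) - siteAvgIter j l₀ (emb y)‖ ≤
          ((P.d : ℝ) * P.L * t / 2) * 2 ^ (j + 1) / 2 ^ k := by
  rintro j hj y ⟨z, hz, rfl⟩ idx
  have hL2 : (2 : ℝ) ≤ P.L := by exact_mod_cast P.hL.2
  have hj' : j + 1 ≤ P.m + P.K := by omega
  set xr : Pt P.d := fun μ => (P.L : ℤ) * z μ + ((idx.1 μ : ℕ) : ℤ) with hxr
  set xc : Pt P.d := fun μ => (P.L : ℤ) * z μ + (((P.L - 1) / 2 : ℕ) : ℤ) with hxc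
  have her : walkEnd (emb (coverAt P (j + 1) z)) (stairWord idx.2.1 (off idx.1)) = coverAt P j xr := by
    rw [walkEnd_emb_stairWord_eq_blockSite, blockSite_coverAt hj']
  have hec : emb (coverAt P (j + 1) z) = coverAt P j xc := emb_coverAt hj' z
  have hunder : ∀ (u : Pt P.d), (∀ μ, 0 ≤ u μ) → (∀ μ, u μ < P.L) →
      blockMap (P.L ^ (k - j)) ((fun μ => (P.L : ℤ) * z μ) + u) = yc := by
    intro u h0 hu
    have hkj : k - j = 0 + 1 + (k - (j + 1)) := by omega
    rw [hkj]
    exact blockMap_pow_of_blockMap_pow_eq (j := 0) h0 hu (by rw [pow_zero]; funext μ; simp [blockMap]) hz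
  have hxr' : blockMap (P.L ^ (k - j)) xr = yc :=
    hunder (fun μ => ((idx.1 μ : ℕ) : ℤ)) (fun _ => by positivity) (fun μ => by exact_mod_cast (idx.1 μ).isLt)
  have hxc' : blockMap (P.L ^ (k - j)) xc = yc :=
    hunder (fun _ => (((P.L - 1) / 2 : ℕ) : ℤ)) (fun _ => by positivity) (fun _ => by exact_mod_cast half_pred_lt_L)
  have hjk : j ≤ k := hj.le
  have h := norm_siteAvgIter_coverAt_sub_le (by omega) l₀ hg xc xr (blockSites_subset_box hjk yc xc hxc')
    (blockSites_subset_box hjk yc xr hxr')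
  rw [her, hec]
  refine h.trans ?_
  have hl1 : (l1 (xr - xc) : ℝ) ≤ (P.d : ℝ) * P.L := by
    have hnat : l1 (xr - xc) ≤ P.d * P.L := by
      unfold l1
      calc ∑ κ, ((xr - xc) κ).natAbs ≤ ∑ _κ : Fin P.d, P.L := Finset.sum_le_sum fun κ _ => by
            simp only [hxr, hxc, Pi.sub_apply, add_sub_add_left_eq_sub]
            have h1 := (idx.1 κ).isLt
            have h2 : ((P.L - 1) / 2 : ℕ) < P.L := half_pred_lt_L
            omega
        _ = P.d * P.L := by rw [Finset.sum_const, Finset.card_univ, Fintype.card_fin, smul_eq_mul]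
    exact_mod_cast hnat
  calc (l1 (xr - xc) : ℝ) * (P.L : ℝ) ^ j * (t * ((P.L : ℝ) ^ k)⁻¹)
      = (l1 (xr - xc) : ℝ) * t * ((P.L : ℝ) ^ j * ((P.L : ℝ) ^ k)⁻¹) := by ring
    _ ≤ ((P.d : ℝ) * P.L) * t * (2 ^ j / 2 ^ k) := by
        gcongr
        exact pow_div_pow_le_two hL2 hjk
    _ = ((P.d : ℝ) * P.L * t / 2) * 2 ^ (j + 1) / 2 ^ k := by rw [pow_succ]; ring

end Transfer

/-! ## §3 The value row (1.121) + `exp ∘ log = id` for the top effective gauge, from the local tower induction -/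

section Rows

variable {𝔸 : Type*} [NormedRing 𝔸] [NormedAlgebra ℂ 𝔸] [CompleteSpace 𝔸]

/-- ★★ **THE VALUE ROW OF THE TOP MEMBER FROM THE LOCAL TOWER** — the `hTop121` text of ✓`P1FlatCoreTopStepTorus.hFP_kLevel_top_RD` at a top label `yc`:
for a fine field `l₀` on the torus whose cover-reading is `α₄`-small with `α₄L^{−k}`-small steps on the tower box `[tlo L yc k, thi L yc k]` ((1.120) at the
flat background), and a field `W` whose double-bar stairs are within `δ` of `1` on every block under `yc` (`hH`, z-parametrised), under the window
`160(α₄ + δ + 5ω) ≤ ¼`, `ω := d·L·α₄∕2`: the top effective gauge `κ_k[l₀](π_k yc)` of ANY tower `κ` obeying the recursion (97)∕(100) with `κ_0 = e^{l₀}` is the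
exponential of its logarithm and `‖log κ_k(π_k yc) − (Q′_k l₀)(π_k yc)‖ ≤ 640(α₄ + δ + 5ω)ω`.
[cite: Balaban1985RegularSpaces, Sect. E (1.120)-(1.121) pp.95-96; Balaban1985Averaging, (97)-(100) p.32] -/
theorem top121_of_local [Nonempty (Idx P)] {k : ℕ} (hk : k ≤ P.m + P.K) (W : GaugeField P 0 𝔸ˣ)
    (κ : (i : ℕ) → GaugeTransf P i 𝔸ˣ)
    (hs : ∀ (i : ℕ) (y : Site P (i + 1)),
      κ (i + 1) y = (vframeU (gaugeActT (κ i) (dbarIterU i W)) y)⁻¹ * κ i (emb y) * vframeU (dbarIterU i W) y)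
    (l₀ : Site P 0 → 𝔸) (hκ0 : ∀ x, ((κ 0 x : 𝔸ˣ) : 𝔸) = exp (l₀ x)) {α₄ δ : ℝ} (hα₄ : 0 ≤ α₄) (hδ : 0 ≤ δ)
    (yc : Pt P.d)
    (hH : ∀ j < k, ∀ z : Pt P.d, blockMap (P.L ^ (k - (j + 1))) z = yc → ∀ idx : Idx P,
      ‖((holT (dbarIterU j W) (emb (coverAt P (j + 1) z)) (stairWord idx.2.1 (off idx.1)) : 𝔸ˣ) : 𝔸) - 1‖ ≤ δ)
    (hr : 160 * (α₄ + δ + 5 * ((P.d : ℝ) * P.L * α₄ / 2)) ≤ 1 / 4)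
    (hb : ∀ x : Pt P.d, InBox (tlo P.L yc k) (thi P.L yc k) x → ‖l₀ (cover P x)‖ ≤ α₄)
    (hg : ∀ (x : Pt P.d) (ν : Fin P.d), InBox (tlo P.L yc k) (thi P.L yc k) x → InBox (tlo P.L yc k) (thi P.L yc k) (x + e ν) →
      ‖l₀ (cover P (x + e ν)) - l₀ (cover P x)‖ ≤ α₄ * ((P.L : ℝ) ^ k)⁻¹) :
    exp (mlog ((κ k (coverAt P k yc) : 𝔸ˣ) : 𝔸)) = ((κ k (coverAt P k yc) : 𝔸ˣ) : 𝔸) ∧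
      ‖mlog ((κ k (coverAt P k yc) : 𝔸ˣ) : 𝔸) - siteAvgIter k l₀ (coverAt P k yc)‖ ≤
        640 * (α₄ + δ + 5 * ((P.d : ℝ) * P.L * α₄ / 2)) * ((P.d : ℝ) * P.L * α₄ / 2) := by
  have hω0 : 0 ≤ (P.d : ℝ) * P.L * α₄ / 2 := by positivity
  have hH' : ∀ j < k, ∀ y ∈ {w : Site P (j + 1) | ∃ z : Pt P.d, blockMap (P.L ^ (k - (j + 1))) z = yc ∧ w = coverAt P (j + 1) z},
      ∀ idx : Idx P, ‖((holT (dbarIterU j W) (emb y) (stairWord idx.2.1 (off idx.1)) : 𝔸ˣ) : 𝔸) - 1‖ ≤ δ := by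
    rintro j hj y ⟨z, hz, rfl⟩ idx; exact hH j hj z hz idx
  exact norm_mlog_effGauge_top_sub_siteAvgIter_le_local W κ hs l₀ hκ0 hα₄ hδ hω0 k
    (fun j => {w : Site P j | ∃ z : Pt P.d, blockMap (P.L ^ (k - j)) z = yc ∧ w = coverAt P j z})
    (fun j hj y hy => by obtain ⟨z, hz, rfl⟩ := hy; obtain ⟨w, hw, he⟩ := emb_mem_family hj hk yc z hz; exact ⟨w, hw, he⟩)
    (fun j hj y hy idx => by obtain ⟨z, hz, rfl⟩ := hy; obtain ⟨w, hw, he⟩ := stairEnd_mem_family hj hk yc z hz idx; exact ⟨w, hw, he⟩)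
    (sup_on_family yc l₀ hb) hH' (osc_on_family hk yc l₀ hα₄ hg) hr (coverAt P k yc) (coverAt_mem_family k yc)

end Rows

/-! ## §4 (v1.1) The Lipschitz row (1.125) of the top member, from ★w3-19936 g6's LOCAL Cauchy row ✓`P1FlatCoreFrameLinLipschitzLocal.norm_Cnl_sub_Cnl_le_local` -/

section Rows125

open Summit.QuantumFields.YangMills.Theorems.P1FlatCoreFrameLinLipschitzLocal (norm_Cnl_sub_Cnl_le_local)

variable {𝔸 : Type*} [NormedRing 𝔸] [NormedAlgebra ℂ 𝔸] [CompleteSpace 𝔸]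

/-- ★★ **THE LIPSCHITZ ROW (1.125) OF THE TOP MEMBER FROM THE LOCAL TOWER** — the `hTop125` text of ✓`hFP_kLevel_top_RD` at a top label `yc`, for ALL
moduli `m ≥ 0`: small moduli (`d·L·m ≤ r∕4`) by the local Cauchy row ✓`P1FlatCoreFrameLinLipschitzLocal.norm_Cnl_sub_Cnl_le_local` along `ν := l₁ − l₂`
(`n := d·L·m` bounds both `ν` and its linear oscillations), large moduli by the two value bounds of `top121_of_local`; constant `Cl := 8·M·d·L∕r`,
`M := 640(α₄ + r + δ + 5(ω + r))(ω + r)`, `ω := d·L·α₄∕2`, window `160(α₄ + r + δ + 5(ω + r)) ≤ ¼`.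
[cite: Balaban1985RegularSpaces, Sect. E (1.122)-(1.125) pp.96-97] -/
theorem top125_of_local [Nonempty (Idx P)] {k : ℕ} (hk : k ≤ P.m + P.K) (W : GaugeField P 0 𝔸ˣ)
    (κf : (Site P 0 → 𝔸) → (i : ℕ) → GaugeTransf P i 𝔸ˣ)
    (hs : ∀ (m : Site P 0 → 𝔸) (i : ℕ) (y : Site P (i + 1)),
      κf m (i + 1) y = (vframeU (gaugeActT (κf m i) (dbarIterU i W)) y)⁻¹ * κf m i (emb y) * vframeU (dbarIterU i W) y)
    (h0 : ∀ (m : Site P 0 → 𝔸) (x : Site P 0), ((κf m 0 x : 𝔸ˣ) : 𝔸) = exp (m x))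
    {α₄ δ r : ℝ} (hα₄ : 0 ≤ α₄) (hδ : 0 ≤ δ) (hr0 : 0 < r) (yc : Pt P.d)
    (hH : ∀ j < k, ∀ z : Pt P.d, blockMap (P.L ^ (k - (j + 1))) z = yc → ∀ idx : Idx P,
      ‖((holT (dbarIterU j W) (emb (coverAt P (j + 1) z)) (stairWord idx.2.1 (off idx.1)) : 𝔸ˣ) : 𝔸) - 1‖ ≤ δ)
    (hr : 160 * (α₄ + r + δ + 5 * ((P.d : ℝ) * P.L * α₄ / 2 + r)) ≤ 1 / 4)
    (l₁ l₂ : Site P 0 → 𝔸) (m : ℝ) (hm : 0 ≤ m)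
    (h1b : ∀ x : Pt P.d, InBox (tlo P.L yc k) (thi P.L yc k) x → ‖l₁ (cover P x)‖ ≤ α₄)
    (h1g : ∀ (x : Pt P.d) (ν : Fin P.d), InBox (tlo P.L yc k) (thi P.L yc k) x → InBox (tlo P.L yc k) (thi P.L yc k) (x + e ν) →
      ‖l₁ (cover P (x + e ν)) - l₁ (cover P x)‖ ≤ α₄ * ((P.L : ℝ) ^ k)⁻¹)
    (h2b : ∀ x : Pt P.d, InBox (tlo P.L yc k) (thi P.L yc k) x → ‖l₂ (cover P x)‖ ≤ α₄)
    (h2g : ∀ (x : Pt P.d) (ν : Fin P.d), InBox (tlo P.L yc k) (thi P.L yc k) x → InBox (tlo P.L yc k) (thi P.L yc k) (x + e ν) →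
      ‖l₂ (cover P (x + e ν)) - l₂ (cover P x)‖ ≤ α₄ * ((P.L : ℝ) ^ k)⁻¹)
    (hmb : ∀ x : Pt P.d, InBox (tlo P.L yc k) (thi P.L yc k) x → ‖l₁ (cover P x) - l₂ (cover P x)‖ ≤ m)
    (hmg : ∀ (x : Pt P.d) (ν : Fin P.d), InBox (tlo P.L yc k) (thi P.L yc k) x → InBox (tlo P.L yc k) (thi P.L yc k) (x + e ν) →
      ‖(l₁ (cover P (x + e ν)) - l₂ (cover P (x + e ν))) - (l₁ (cover P x) - l₂ (cover P x))‖ ≤ m * ((P.L : ℝ) ^ k)⁻¹) :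
    ‖(mlog ((κf l₁ k (coverAt P k yc) : 𝔸ˣ) : 𝔸) - siteAvgIter k l₁ (coverAt P k yc)) -
        (mlog ((κf l₂ k (coverAt P k yc) : 𝔸ˣ) : 𝔸) - siteAvgIter k l₂ (coverAt P k yc))‖ ≤
      (8 * (640 * (α₄ + r + δ + 5 * ((P.d : ℝ) * P.L * α₄ / 2 + r)) * ((P.d : ℝ) * P.L * α₄ / 2 + r)) * ((P.d : ℝ) * P.L) / r) * m := by
  set ω : ℝ := (P.d : ℝ) * P.L * α₄ / 2 with hω
  set M : ℝ := 640 * (α₄ + r + δ + 5 * (ω + r)) * (ω + r) with hM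
  have hω0 : 0 ≤ ω := by positivity
  have hM0 : 0 ≤ M := by positivity
  have hd1 : (1 : ℝ) ≤ P.d := by exact_mod_cast P.hd
  have hL1 : (1 : ℝ) ≤ P.L := by exact_mod_cast P.L_pos
  have hdL1 : (1 : ℝ) ≤ (P.d : ℝ) * P.L := by nlinarith
  -- the family and its closures
  let S : (j : ℕ) → Set (Site P j) := fun j => {w | ∃ z : Pt P.d, blockMap (P.L ^ (k - j)) z = yc ∧ w = coverAt P j z}
  have hSe : ∀ j < k, ∀ y ∈ S (j + 1), emb y ∈ S j := fun j hj y hy => by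
    obtain ⟨z, hz, rfl⟩ := hy; obtain ⟨w, hw, he⟩ := emb_mem_family hj hk yc z hz; exact ⟨w, hw, he⟩
  have hSs : ∀ j < k, ∀ y ∈ S (j + 1), ∀ idx : Idx P, walkEnd (emb y) (stairWord idx.2.1 (off idx.1)) ∈ S j := fun j hj y hy idx => by
    obtain ⟨z, hz, rfl⟩ := hy; obtain ⟨w, hw, he⟩ := stairEnd_mem_family hj hk yc z hz idx; exact ⟨w, hw, he⟩
  have hH' : ∀ j < k, ∀ y ∈ S (j + 1), ∀ idx : Idx P,
      ‖((holT (dbarIterU j W) (emb y) (stairWord idx.2.1 (off idx.1)) : 𝔸ˣ) : 𝔸) - 1‖ ≤ δ := by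
    rintro j hj y ⟨z, hz, rfl⟩ idx; exact hH j hj z hz idx
  have hyc : coverAt P k yc ∈ S k := coverAt_mem_family k yc
  -- the two regimes
  by_cases hsmall : (P.d : ℝ) * P.L * m ≤ r / 4
  · -- Cauchy regime: `μ := l₂`, `ν := l₁ − l₂`, `n := dLm`
    set ν : Site P 0 → 𝔸 := fun s => l₁ s - l₂ s with hν
    have hsum : l₂ + ν = l₁ := by funext s; simp [hν]
    have hνn : ∀ x ∈ S 0, ‖ν x‖ ≤ (P.d : ℝ) * P.L * m := by
      intro x hx
      have h := sup_on_family yc ν (a := m) (fun z hz => hmb z hz) x hx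
      calc ‖ν x‖ ≤ m := h
        _ = 1 * m := (one_mul m).symm
        _ ≤ (P.d : ℝ) * P.L * m := mul_le_mul_of_nonneg_right hdL1 hm
    have hνosc : ∀ j < k, ∀ y ∈ S (j + 1), ∀ idx : Idx P,
        ‖siteAvgIter j ν (walkEnd (emb y) (stairWord idx.2.1 (off idx.1))) - siteAvgIter j ν (emb y)‖ ≤
          ((P.d : ℝ) * P.L * m) * 2 ^ (j + 1) / 2 ^ k := by
      intro j hj y hy idx
      have h := osc_on_family hk yc ν hm (fun x μ hx hxe => hmg x μ hx hxe) j hj y hy idx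
      refine h.trans ?_
      have h2 : (0 : ℝ) ≤ 2 ^ (j + 1) / 2 ^ k := by positivity
      have : (P.d : ℝ) * P.L * m / 2 ≤ (P.d : ℝ) * P.L * m := by
        have : 0 ≤ (P.d : ℝ) * P.L * m := by positivity
        linarith
      calc (P.d : ℝ) * ↑P.L * m / 2 * 2 ^ (j + 1) / 2 ^ k = ((P.d : ℝ) * P.L * m / 2) * (2 ^ (j + 1) / 2 ^ k) := by ring
        _ ≤ ((P.d : ℝ) * P.L * m) * (2 ^ (j + 1) / 2 ^ k) := mul_le_mul_of_nonneg_right this h2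
        _ = (P.d : ℝ) * ↑P.L * m * 2 ^ (j + 1) / 2 ^ k := by ring
    have h := norm_Cnl_sub_Cnl_le_local W κf hs h0 hα₄ hδ hω0 (by positivity : (0 : ℝ) ≤ (P.d : ℝ) * P.L * m) hr0 hsmall k S hSe hSs hH'
      l₂ ν (sup_on_family yc l₂ h2b) hνn (osc_on_family hk yc l₂ hα₄ h2g) hνosc hr (coverAt P k yc) hyc
    rw [hsum] at h
    refine h.trans ?_
    rw [← hM]
    have : 2 * M * ((P.d : ℝ) * P.L * m) / r ≤ 8 * M * ((P.d : ℝ) * P.L) / r * m := by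
      rw [div_mul_eq_mul_div]
      apply div_le_div_of_nonneg_right _ hr0.le
      nlinarith [mul_nonneg hM0 (mul_nonneg (mul_nonneg (Nat.cast_nonneg P.d) (Nat.cast_nonneg P.L)) hm)]
    exact this
  · -- large moduli: two value bounds
    push Not at hsmall
    have hrv : 160 * (α₄ + δ + 5 * ((P.d : ℝ) * P.L * α₄ / 2)) ≤ 1 / 4 := by
      refine le_trans ?_ hr
      have : 0 ≤ r := hr0.le
      nlinarith
    have hv1 := (top121_of_local hk W (κf l₁) (hs l₁) l₁ (h0 l₁) hα₄ hδ yc hH hrv h1b h1g).2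
    have hv2 := (top121_of_local hk W (κf l₂) (hs l₂) l₂ (h0 l₂) hα₄ hδ yc hH hrv h2b h2g).2
    have hCb : 640 * (α₄ + δ + 5 * ((P.d : ℝ) * P.L * α₄ / 2)) * ((P.d : ℝ) * P.L * α₄ / 2) ≤ M := by
      rw [hM, hω]
      have h5 : α₄ + δ + 5 * ((P.d : ℝ) * P.L * α₄ / 2) ≤ α₄ + r + δ + 5 * ((P.d : ℝ) * P.L * α₄ / 2 + r) := by nlinarith [hr0.le]
      have h6 : (P.d : ℝ) * P.L * α₄ / 2 ≤ (P.d : ℝ) * P.L * α₄ / 2 + r := by linarith [hr0.le]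
      have h7 : 0 ≤ α₄ + δ + 5 * ((P.d : ℝ) * P.L * α₄ / 2) := by positivity
      calc 640 * (α₄ + δ + 5 * ((P.d : ℝ) * P.L * α₄ / 2)) * ((P.d : ℝ) * P.L * α₄ / 2)
          ≤ 640 * (α₄ + r + δ + 5 * ((P.d : ℝ) * P.L * α₄ / 2 + r)) * ((P.d : ℝ) * P.L * α₄ / 2) := by gcongr
        _ ≤ 640 * (α₄ + r + δ + 5 * ((P.d : ℝ) * P.L * α₄ / 2 + r)) * ((P.d : ℝ) * P.L * α₄ / 2 + r) := by gcongr
    calc ‖(mlog ((κf l₁ k (coverAt P k yc) : 𝔸ˣ) : 𝔸) - siteAvgIter k l₁ (coverAt P k yc)) -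
          (mlog ((κf l₂ k (coverAt P k yc) : 𝔸ˣ) : 𝔸) - siteAvgIter k l₂ (coverAt P k yc))‖
        ≤ M + M := (norm_sub_le _ _).trans (add_le_add (hv1.trans hCb) (hv2.trans hCb))
      _ ≤ 8 * M * ((P.d : ℝ) * P.L) / r * m := by
          -- `dLm ∕ r > 1∕4` ⇒ `8 M dL m ∕ r ≥ 2M`
          have hq : 1 / 4 < (P.d : ℝ) * P.L * m / r := by rw [lt_div_iff₀ hr0]; linarith
          have : 8 * M * ((P.d : ℝ) * P.L) / r * m = 8 * M * ((P.d : ℝ) * P.L * m / r) := by ring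
          rw [this]
          nlinarith

end Rows125

end Summit.QuantumFields.YangMills.Theorems.P1FlatCoreTopRowsLocal

end
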